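import Literature.AlgebraicGeometry.Resolution.FiniteOverCompleteLocal
import Literature.LinearAlgebra.Matrix.NonderogatoryCommutantBaseChange
import Literature.NumberTheory.LocalFields.UnramifiedQuadraticNormSemilocal
import Mathlib.NumberTheory.LocalField.Basic
import Mathlib.RingTheory.AdjoinRoot
import Mathlib.LinearAlgebra.Matrix.Charpoly.Minpoly
import Mathlib.Algebra.Polynomial.Lifts
import HarnessLib

/-!
# The commutant order `𝒪_E[γ]` of a residually separable integral matrix over a non-archimedean local field
# (Kottwitz (1986) Prop. 7.1 inputs; Rogawski (1990) §4.3 p. 43)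

Topic `NumberTheory/LocalFields`; namespace `Literature.NumberTheory.LocalFields`. THEOREMS ONLY (no definition, no instance, no notation, no named fact).
Cell `hodgecm-mathlib`, F0∕P3a road letter «D-S3u», brick «D-S3u-K1» (LEAD F0P3a-plan (g8) T7-51; consumer: the floor-2 discharge of A-p01 (g19)'s binder
`hK1` via ★ `UnramifiedQuadraticNorm.exists_mul_map_eq_of_isReduced_quotient` — the norm equation on the COMMUTANT ORDER `B = 𝒪_w[γ]`, whose three
instance binders `[IsAdicComplete I B] [Finite (B ⧸ I)] [IsReduced (B ⧸ I)]` this file discharges, and whose identification with the matrix commutant it proves).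

Setting: `E` a non-archimedean local field (`[ValuativeRel E] [UniformSpace E] [IsUniformAddGroup E] [IsNonarchimedeanLocalField E]`, so that Mathlib's
`IsAdicComplete 𝓂[E] 𝒪[E]` and `IsDiscreteValuationRing 𝒪[E]` fire), `γ : Matrix (Fin N) (Fin N) 𝒪[E]` RESIDUALLY SEPARABLE:
`hsep : (γ.charpoly.map (IsLocalRing.residue 𝒪[E])).Separable` (the reduction `γ̄` is regular semisimple). The COMMUTATIVE MODEL of `B = 𝒪_E[γ]` is the abstract
order `AdjoinRoot γ.charpoly = 𝒪_E[X] ∕ (χ_γ)` (a `CommRing` TYPE, as ★ (h1)'s `R` must be), docked to matrices by `p ↦ p(γ)`.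

* §1 THE ABSTRACT ORDER (`χ : 𝒪[E][X]`): **`isAdicComplete_adjoinRoot`** (`χ` monic ⇒ `AdjoinRoot χ` is `𝔪·AdjoinRoot χ`-adically complete — ★
  `Resolution.isAdicComplete_map_of_finite`, Matsumura 8.7, at the finite free `𝒪`-module `AdjoinRoot χ`); **`finite_adjoinRoot_quotient`** (`χ̄ ≠ 0` ⇒
  `AdjoinRoot χ ⧸ 𝔪 ≅ 𝓀[X]∕(χ̄)` finite, Mathlib `AdjoinRoot.quotAdjoinRootEquivQuotPolynomialQuot`); **`isReduced_adjoinRoot_quotient`** (`χ̄` separable ⇒ squarefree ⇒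
  `(χ̄)` radical ⇒ `𝓀[X]∕(χ̄)` reduced); and the norm equation **`exists_mul_map_eq_adjoinRoot`** = ★ (h1) with its three instance binders DISCHARGED: for every
  involution `σ` of `AdjoinRoot χ` preserving `𝔪·AdjoinRoot χ` and moving some element by a unit, every `σ`-fixed unit is a norm `s · σ s`.
* §2 SCALING (`E` any valued field): `exists_smul_map_eq_of_ne_zero` — every `p ∈ E[X] ∖ 0` is `c • q` with `c ≠ 0`, `q ∈ 𝒪[X]`, `q̄ ≠ 0`, `deg q = deg p`
  (divide by a coefficient of maximal valuation).
* §3 THE COMMUTANT BY REDUCTION (no discriminant, no integral closure): (R) `map_residue_eq_zero_of_aeval_map_residue_eq_zero` — `minpoly_𝓀 γ̄ = χ̄_γ`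
  (★ `minpoly_eq_charpoly_of_charpoly_separable`) kills every `q ∈ 𝒪[X]` with `deg q < N`, `q(γ) ≡ 0 (mod 𝔪)`, `q̄ ≠ 0`; hence **`eq_zero_of_aeval_eq_zero_of_natDegree_lt`**
  (`deg r < N`, `r(γ) = 0` ⇒ `r = 0`, by §2), **`charpoly_dvd_of_aeval_eq_zero`** (`𝒪[X]∕(χ_γ) ↪ M_N(𝒪)`), **`minpoly_map_eq_charpoly`** (`γ` is regular over `E`),
  **`exists_eq_aeval_of_commute_residuallySeparable`** (THE COMMUTANT: every `x ∈ M_N(𝒪_E)` commuting with `γ` is `p(γ)`, `p ∈ 𝒪_E[X]`, `deg p < N` — ★ field commutant over `E`,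
  then `p ∈ 𝒪[X]` because otherwise §2 scales `p` into `𝔪`-multiples contradicting (R): the maximal-order fact `E[γ] ∩ M_N(𝒪) = 𝒪[γ]`),
  `commute_of_commute_residuallySeparable` (the commutant is commutative), **`centralizer_eq_range_aeval_residuallySeparable`**, and **`exists_algEquiv_adjoinRoot_centralizer`**
  (`AdjoinRoot χ_γ ≃ₐ[𝒪] Z_{M_N(𝒪)}(γ)`, `mk p ↦ p(γ)` — the `CommRing` transport for the consumer).
NOT here (FILE 2): the unitary involution `τ = Ad(J⁻¹) ∘ σᵀ` on `B` and «`τ` moves a coordinate by a unit».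

## References
* [Kottwitz1986] R. E. Kottwitz, *Base change for unit elements of Hecke algebras*, Compositio Math. 60 (1986), §7, Prop. 7.1 (the norm equation on `𝒪[γ]`).
* [Rogawski1990] J. D. Rogawski, *Automorphic Representations of Unitary Groups in Three Variables* (1990), §4.3 p. 43.
* [Serre1979] J.-P. Serre, *Local Fields* (1979), Ch. V §2 Prop. 3 and Cor.
* [Matsumura1987] H. Matsumura, *Commutative Ring Theory* (1987), Thm. 8.7.
* [HornJohnson2013] R. A. Horn, C. R. Johnson, *Matrix Analysis* (2013), Thm. 3.2.4.2.
-/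

set_option autoImplicit false

noncomputable section

open Polynomial IsLocalRing ValuativeRel Matrix
open Literature.LinearAlgebra.Matrix Literature.NumberTheory.LocalFields.UnramifiedQuadraticNorm

namespace Literature.NumberTheory.LocalFields

/-! ### §1 The abstract order `AdjoinRoot χ = 𝒪[X] ∕ (χ)` -/

section Residue

variable {E : Type*} [Field E] [ValuativeRel E]

/-- **`𝓀[X]∕(χ̄)` is reduced for `χ̄` separable** (separable ⇒ squarefree ⇒ `(χ̄)` radical), transported to `𝒪_E[X]∕(χ) ⧸ 𝔪` along Mathlib's
`AdjoinRoot.quotAdjoinRootEquivQuotPolynomialQuot`. [cite: Serre1979, Ch. V §2] -/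
theorem isReduced_adjoinRoot_quotient (χ : 𝒪[E][X]) (hsep : (χ.map (IsLocalRing.residue 𝒪[E])).Separable) :
    IsReduced (AdjoinRoot χ ⧸ (maximalIdeal 𝒪[E]).map (AdjoinRoot.of χ)) := by
  let e : (AdjoinRoot χ ⧸ (maximalIdeal 𝒪[E]).map (AdjoinRoot.of χ)) ≃+* AdjoinRoot (χ.map (IsLocalRing.residue 𝒪[E])) :=
    AdjoinRoot.quotAdjoinRootEquivQuotPolynomialQuot (maximalIdeal 𝒪[E]) χ
  have hrad : (Ideal.span {χ.map (IsLocalRing.residue 𝒪[E])}).IsRadical := isRadical_iff_span_singleton.mp hsep.squarefree.isRadical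
  haveI : IsReduced (AdjoinRoot (χ.map (IsLocalRing.residue 𝒪[E]))) := by
    unfold AdjoinRoot
    exact (Ideal.isRadical_iff_quotient_reduced _).mp hrad
  exact isReduced_of_injective e e.injective

end Residue

section ResidueFinite

variable {E : Type*} [Field E] [ValuativeRel E] [TopologicalSpace E] [IsNonarchimedeanLocalField E]

/-- **`𝒪_E[X]∕(χ) ⧸ 𝔪 = 𝓀[X]∕(χ̄)` is finite** for `χ̄ ≠ 0` (`𝓀` is finite). [cite: Serre1979, Ch. V §2] -/
theorem finite_adjoinRoot_quotient (χ : 𝒪[E][X]) (h0 : χ.map (IsLocalRing.residue 𝒪[E]) ≠ 0) :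
    Finite (AdjoinRoot χ ⧸ (maximalIdeal 𝒪[E]).map (AdjoinRoot.of χ)) := by
  let e : (AdjoinRoot χ ⧸ (maximalIdeal 𝒪[E]).map (AdjoinRoot.of χ)) ≃+* AdjoinRoot (χ.map (IsLocalRing.residue 𝒪[E])) :=
    AdjoinRoot.quotAdjoinRootEquivQuotPolynomialQuot (maximalIdeal 𝒪[E]) χ
  haveI : Module.Finite 𝓀[E] (AdjoinRoot (χ.map (IsLocalRing.residue 𝒪[E]))) := (AdjoinRoot.powerBasis h0).finite
  haveI : Finite (AdjoinRoot (χ.map (IsLocalRing.residue 𝒪[E]))) := Module.finite_of_finite 𝓀[E]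
  exact Finite.of_equiv _ e.symm.toEquiv

end ResidueFinite

section Order

variable {E : Type*} [Field E] [ValuativeRel E] [UniformSpace E] [IsUniformAddGroup E] [IsNonarchimedeanLocalField E]

/-- **`𝒪_E[X]∕(χ)` is `𝔪`-adically complete** for `χ` monic: a finite free module over the complete Noetherian local ring `𝒪_E` (★ Matsumura 8.7,
`Resolution.isAdicComplete_map_of_finite`). [cite: Matsumura1987, Thm. 8.7] -/
theorem isAdicComplete_adjoinRoot (χ : 𝒪[E][X]) (hχ : χ.Monic) :
    IsAdicComplete ((maximalIdeal 𝒪[E]).map (AdjoinRoot.of χ)) (AdjoinRoot χ) := by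
  haveI : Module.Finite 𝒪[E] (AdjoinRoot χ) := (AdjoinRoot.powerBasis' hχ).finite
  rw [← AdjoinRoot.algebraMap_eq]
  exact Literature.AlgebraicGeometry.Resolution.isAdicComplete_map_of_finite 𝒪[E] (AdjoinRoot χ) (maximalIdeal 𝒪[E])

/-- **The norm equation on the order `𝒪_E[X]∕(χ)`** (`χ` monic, `χ̄` separable): for every involution `σ` of `AdjoinRoot χ` preserving `𝔪 · AdjoinRoot χ` and
moving some element by a unit, every `σ`-fixed unit is a norm `s · σ s` — ★ `exists_mul_map_eq_of_isReduced_quotient` with its three instance binders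
(complete, finite residue ring, reduced residue ring) DISCHARGED by §1. [cite: Kottwitz1986, §7 Prop. 7.1] [cite: Serre1979, Ch. V §2 Prop. 3] -/
theorem exists_mul_map_eq_adjoinRoot (χ : 𝒪[E][X]) (hχ : χ.Monic) (hsep : (χ.map (IsLocalRing.residue 𝒪[E])).Separable)
    (σ : AdjoinRoot χ →+* AdjoinRoot χ) (hσ : ∀ a, σ (σ a) = a)
    (hσI : ∀ a ∈ (maximalIdeal 𝒪[E]).map (AdjoinRoot.of χ), σ a ∈ (maximalIdeal 𝒪[E]).map (AdjoinRoot.of χ))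
    {a : AdjoinRoot χ} (ha : IsUnit (σ a - a)) (u : AdjoinRoot χ) (hu : IsUnit u) (hσu : σ u = u) :
    ∃ s : AdjoinRoot χ, s * σ s = u := by
  haveI := isAdicComplete_adjoinRoot χ hχ
  haveI := finite_adjoinRoot_quotient χ hsep.ne_zero
  haveI := isReduced_adjoinRoot_quotient χ hsep
  exact exists_mul_map_eq_of_isReduced_quotient σ hσ hσI ha u hu hσu

end Order

/-! ### §2 Scaling a polynomial over a valued field into `𝒪[X]` with non-zero reduction -/

section Scaling

variable {E : Type*} [Field E] [ValuativeRel E]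

/-- **Scaling**: every non-zero `p ∈ E[X]` is `c • q` with `c ≠ 0` (a coefficient of maximal valuation), `q ∈ 𝒪_E[X]` with NON-ZERO reduction `q̄` and the same
degree. [cite: Serre1979, Ch. V §2] -/
theorem exists_smul_map_eq_of_ne_zero (p : E[X]) (hp : p ≠ 0) :
    ∃ (c : E) (q : 𝒪[E][X]), c ≠ 0 ∧ p = c • q.map (algebraMap 𝒪[E] E) ∧ q.map (IsLocalRing.residue 𝒪[E]) ≠ 0 ∧
      q.natDegree = p.natDegree := by
  classical
  have hne : p.support.Nonempty := Finset.nonempty_iff_ne_empty.2 (mt Polynomial.support_eq_empty.1 hp)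
  obtain ⟨i₀, hi₀, hmax⟩ := Finset.exists_max_image p.support (fun i => valuation E (p.coeff i)) hne
  set c := p.coeff i₀ with hc_def
  have hc : c ≠ 0 := Polynomial.mem_support_iff.1 hi₀
  have hvc : valuation E c ≠ 0 := (Valuation.ne_zero_iff _).2 hc
  -- `c⁻¹ • p` has integral coefficients
  have hlift : c⁻¹ • p ∈ Polynomial.lifts (algebraMap 𝒪[E] E) := by
    rw [Polynomial.lifts_iff_coeff_lifts]
    intro n
    rw [Polynomial.coeff_smul, smul_eq_mul]
    by_cases hn : n ∈ p.support
    · have hle : valuation E (p.coeff n) ≤ valuation E c := hmax n hn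
      refine ⟨⟨c⁻¹ * p.coeff n, ?_⟩, rfl⟩
      rw [Valuation.mem_integer_iff, map_mul, map_inv₀, inv_mul_eq_div]
      exact (div_le_one₀ (zero_lt_iff.2 hvc)).2 hle
    · rw [Polynomial.notMem_support_iff.1 hn, mul_zero]
      exact ⟨0, map_zero _⟩
  obtain ⟨q, hqmap, hqdeg⟩ := Polynomial.exists_degree_eq_of_mem_lifts hlift
  have hdeg' : (c⁻¹ • p).degree = p.degree := by rw [smul_eq_C_mul, degree_C_mul (inv_ne_zero hc)]
  refine ⟨c, q, hc, ?_, ?_, natDegree_eq_of_degree_eq (hqdeg.trans hdeg')⟩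
  · rw [hqmap, smul_smul, mul_inv_cancel₀ hc, one_smul]
  · intro h0
    have h1 : algebraMap 𝒪[E] E (q.coeff i₀) = 1 := by
      rw [← Polynomial.coeff_map, hqmap, coeff_smul, smul_eq_mul, inv_mul_cancel₀ hc]
    have h2 : q.coeff i₀ = 1 := Subtype.ext h1
    have h3 := congrArg (fun r : 𝓀[E][X] => r.coeff i₀) h0
    simp only [Polynomial.coeff_map, h2, map_one, coeff_zero] at h3
    exact one_ne_zero h3

end Scaling

/-! ### §3 The commutant of a residually separable integral matrix -/

section Commutant

variable {E : Type*} [Field E] [ValuativeRel E] {N : ℕ} (γ : Matrix (Fin N) (Fin N) 𝒪[E])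

/-- `p(γ)` reduces to `p̄(γ̄)`. [folklore] -/
private theorem aeval_map_residue (p : 𝒪[E][X]) :
    (aeval γ p).map (IsLocalRing.residue 𝒪[E]) = aeval (γ.map (IsLocalRing.residue 𝒪[E])) (p.map (IsLocalRing.residue 𝒪[E])) := by
  have h := (aeval_algHom_apply ((Algebra.ofId 𝒪[E] 𝓀[E]).mapMatrix) γ p).symm
  rw [AlgHom.mapMatrix_apply, AlgHom.mapMatrix_apply] at h
  rw [← IsLocalRing.ResidueField.algebraMap_eq, aeval_map_algebraMap]
  exact h

/-- `p(γ)` maps to `p(γ)` over `E`. [folklore] -/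
private theorem aeval_map_coe (p : 𝒪[E][X]) :
    (aeval γ p).map (algebraMap 𝒪[E] E) = aeval (γ.map (algebraMap 𝒪[E] E)) (p.map (algebraMap 𝒪[E] E)) := by
  have h := (aeval_algHom_apply ((Algebra.ofId 𝒪[E] E).mapMatrix) γ p).symm
  rw [AlgHom.mapMatrix_apply, AlgHom.mapMatrix_apply] at h
  rw [aeval_map_algebraMap]
  exact h

/-- **(R) Reduction kills nothing short**: for `γ̄` with separable characteristic polynomial (so `minpoly_𝓀 γ̄ = χ̄_γ` of degree `N`), a polynomial
`q ∈ 𝒪_E[X]` of degree `< N` with `q(γ) ≡ 0 (mod 𝔪)` has `q̄ = 0`. [cite: HornJohnson2013, Thm. 3.2.4.2] [cite: Kottwitz1986, §7 Prop. 7.1] -/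
theorem map_residue_eq_zero_of_aeval_map_residue_eq_zero (hsep : (γ.charpoly.map (IsLocalRing.residue 𝒪[E])).Separable)
    (q : 𝒪[E][X]) (hq : q.natDegree < N) (h : (aeval γ q).map (IsLocalRing.residue 𝒪[E]) = 0) :
    q.map (IsLocalRing.residue 𝒪[E]) = 0 := by
  set γk := γ.map (IsLocalRing.residue 𝒪[E])
  have hchar : γk.charpoly = γ.charpoly.map (IsLocalRing.residue 𝒪[E]) := Matrix.charpoly_map γ _
  have hmin : minpoly 𝓀[E] γk = γk.charpoly := minpoly_eq_charpoly_of_charpoly_separable γk (by rw [hchar]; exact hsep)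
  by_contra hne
  have h0 : aeval γk (q.map (IsLocalRing.residue 𝒪[E])) = 0 := by rw [← aeval_map_residue, h]
  have hdeg := minpoly.degree_le_of_ne_zero 𝓀[E] γk hne h0
  rw [hmin, Matrix.charpoly_degree_eq_dim, Fintype.card_fin] at hdeg
  have hlt : (q.map (IsLocalRing.residue 𝒪[E])).degree < (N : WithBot ℕ) :=
    lt_of_le_of_lt (degree_map_le.trans degree_le_natDegree) (WithBot.coe_lt_coe.2 hq)
  exact absurd (hdeg.trans_lt hlt) (lt_irrefl _)

/-- from `c • aeval γE (q.map ι) = 0`-type information: `q(γ) = 0` over `𝒪` once it vanishes over `E`. [folklore] -/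
private theorem aeval_eq_zero_of_map (q : 𝒪[E][X]) (h : aeval (γ.map (algebraMap 𝒪[E] E)) (q.map (algebraMap 𝒪[E] E)) = 0) :
    aeval γ q = 0 := by
  refine Matrix.map_injective (IsFractionRing.injective 𝒪[E] E) ?_
  change (aeval γ q).map (algebraMap 𝒪[E] E) = (0 : Matrix (Fin N) (Fin N) 𝒪[E]).map (algebraMap 𝒪[E] E)
  rw [aeval_map_coe, h, Matrix.map_zero _ (map_zero _)]

/-- **Short polynomials do not kill `γ`**: `r ∈ 𝒪_E[X]`, `deg r < N`, `r(γ) = 0` ⇒ `r = 0` (scale `r` by §2 into `q` with `q̄ ≠ 0`, `q(γ) = 0`, contradicting (R)).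
[cite: Kottwitz1986, §7 Prop. 7.1] -/
theorem eq_zero_of_aeval_eq_zero_of_natDegree_lt (hsep : (γ.charpoly.map (IsLocalRing.residue 𝒪[E])).Separable)
    (r : 𝒪[E][X]) (hr : r.natDegree < N) (h : aeval γ r = 0) : r = 0 := by
  by_contra hr0
  have hinj : Function.Injective (algebraMap 𝒪[E] E) := IsFractionRing.injective 𝒪[E] E
  have hrE : r.map (algebraMap 𝒪[E] E) ≠ 0 := by rwa [Ne, Polynomial.map_eq_zero_iff hinj]
  obtain ⟨c, q, hc, hcq, hqbar, hqdeg⟩ := exists_smul_map_eq_of_ne_zero (r.map (algebraMap 𝒪[E] E)) hrE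
  -- `q(γ) = 0` over `E`, hence over `𝒪`
  have hE : (aeval (γ.map (algebraMap 𝒪[E] E)) (r.map (algebraMap 𝒪[E] E))) = 0 := by
    rw [← aeval_map_coe, h, Matrix.map_zero _ (map_zero _)]
  rw [hcq, map_smul, smul_eq_zero] at hE
  have hq0 : aeval γ q = 0 := aeval_eq_zero_of_map γ q (hE.resolve_left hc)
  have hqN : q.natDegree < N := by rw [hqdeg, natDegree_map_eq_of_injective hinj]; exact hr
  exact hqbar (map_residue_eq_zero_of_aeval_map_residue_eq_zero γ hsep q hqN (by rw [hq0, Matrix.map_zero _ (map_zero _)]))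

/-- **`𝒪_E[X]∕(χ_γ) ↪ M_N(𝒪_E)`**: `p(γ) = 0 ⇒ χ_γ ∣ p` (reduce `p` modulo the monic `χ_γ` and apply `eq_zero_of_aeval_eq_zero_of_natDegree_lt`).
[cite: Kottwitz1986, §7 Prop. 7.1] -/
theorem charpoly_dvd_of_aeval_eq_zero (hsep : (γ.charpoly.map (IsLocalRing.residue 𝒪[E])).Separable)
    (p : 𝒪[E][X]) (h : aeval γ p = 0) : γ.charpoly ∣ p := by
  have hχ : γ.charpoly.Monic := Matrix.charpoly_monic γ
  set r := p %ₘ γ.charpoly with hr_def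
  have hr : aeval γ r = 0 := by
    have := Polynomial.modByMonic_add_div p γ.charpoly
    rw [← this, map_add, map_mul, Matrix.aeval_self_charpoly, zero_mul, add_zero] at h
    exact h
  have hrN : r = 0 := by
    by_cases hr0 : r = 0
    · exact hr0
    refine eq_zero_of_aeval_eq_zero_of_natDegree_lt γ hsep r ?_ hr
    have hlt := Polynomial.natDegree_lt_natDegree hr0 (Polynomial.degree_modByMonic_lt p hχ)
    rwa [Matrix.charpoly_natDegree_eq_dim, Fintype.card_fin] at hlt
  exact (Polynomial.modByMonic_eq_zero_iff_dvd hχ).1 hrN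

/-- **`γ` is regular over `E`**: `minpoly_E γ = χ_γ` (else scale `minpoly_E γ`, of degree `< N`, into `𝒪[X]` by §2 and contradict (R)).
[cite: HornJohnson2013, Thm. 3.2.4.2] [cite: Rogawski1990, §4.3 p. 43] -/
theorem minpoly_map_eq_charpoly (hsep : (γ.charpoly.map (IsLocalRing.residue 𝒪[E])).Separable) :
    minpoly E (γ.map (algebraMap 𝒪[E] E)) = (γ.map (algebraMap 𝒪[E] E)).charpoly := by
  set γE := γ.map (algebraMap 𝒪[E] E)
  have hint : IsIntegral E γE := Matrix.isIntegral γE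
  refine (Polynomial.eq_of_monic_of_dvd_of_natDegree_le (minpoly.monic hint) (Matrix.charpoly_monic γE)
    (Matrix.minpoly_dvd_charpoly γE) ?_).symm
  rw [Matrix.charpoly_natDegree_eq_dim, Fintype.card_fin]
  by_contra hlt
  have hlt' : (minpoly E γE).natDegree < N := not_le.1 hlt
  obtain ⟨c, q, hc, hcq, hqbar, hqdeg⟩ := exists_smul_map_eq_of_ne_zero (minpoly E γE) (minpoly.ne_zero hint)
  have hE : aeval γE (minpoly E γE) = 0 := minpoly.aeval E γE
  rw [hcq, map_smul, smul_eq_zero] at hE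
  have hq0 : aeval γ q = 0 := aeval_eq_zero_of_map γ q (hE.resolve_left hc)
  have hqN : q.natDegree < N := by rw [hqdeg]; exact hlt'
  exact hqbar (map_residue_eq_zero_of_aeval_map_residue_eq_zero γ hsep q hqN (by rw [hq0, Matrix.map_zero _ (map_zero _)]))

/-- **THE COMMUTANT `{x ∈ M_N(𝒪_E) ∣ xγ = γx} = 𝒪_E[γ]`**: every integral matrix commuting with the residually separable `γ` is `p(γ)` with `p ∈ 𝒪_E[X]` of degree
`< N`. Over `E` the commutant is `E[γ]` (★ `exists_eq_aeval_of_commute_of_minpoly_eq_charpoly`, `γ` regular by `minpoly_map_eq_charpoly`); the coefficients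
are integral because otherwise §2 scales `p = c • q` with `c⁻¹ ∈ 𝔪`, so `q(γ) = c⁻¹ x ≡ 0 (mod 𝔪)` with `q̄ ≠ 0`, contradicting (R) — the maximal-order fact
`E[γ] ∩ M_N(𝒪_E) = 𝒪_E[γ]`. [cite: Kottwitz1986, §7 Prop. 7.1] [cite: Rogawski1990, §4.3 p. 43] -/
theorem exists_eq_aeval_of_commute_residuallySeparable (hsep : (γ.charpoly.map (IsLocalRing.residue 𝒪[E])).Separable)
    (x : Matrix (Fin N) (Fin N) 𝒪[E]) (hx : Commute γ x) :
    ∃ p : 𝒪[E][X], p.degree < (N : WithBot ℕ) ∧ x = aeval γ p := by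
  set γE := γ.map (algebraMap 𝒪[E] E)
  have hinj : Function.Injective (algebraMap 𝒪[E] E) := IsFractionRing.injective 𝒪[E] E
  have hMinj : Function.Injective (fun M : Matrix (Fin N) (Fin N) 𝒪[E] => M.map (algebraMap 𝒪[E] E)) :=
    Matrix.map_injective hinj
  have hxE : Commute γE (x.map (algebraMap 𝒪[E] E)) := by
    change γ.map (algebraMap 𝒪[E] E) * x.map (algebraMap 𝒪[E] E) = x.map (algebraMap 𝒪[E] E) * γ.map (algebraMap 𝒪[E] E)
    rw [← Matrix.map_mul, ← Matrix.map_mul, hx.eq]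
  obtain ⟨p, hpdeg, hp⟩ := exists_eq_aeval_of_commute_of_minpoly_eq_charpoly γE _ (minpoly_map_eq_charpoly γ hsep) hxE
  rw [Fintype.card_fin] at hpdeg
  by_cases hp0 : p = 0
  · refine ⟨0, by rw [degree_zero]; exact WithBot.bot_lt_coe N, hMinj ?_⟩
    change x.map (algebraMap 𝒪[E] E) = (aeval γ (0 : 𝒪[E][X])).map (algebraMap 𝒪[E] E)
    rw [hp, hp0, map_zero, map_zero, Matrix.map_zero _ (map_zero _)]
  obtain ⟨c, q, hc, hcq, hqbar, hqdeg⟩ := exists_smul_map_eq_of_ne_zero p hp0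
  have hq0 : q ≠ 0 := by
    intro hq0; rw [hq0, Polynomial.map_zero] at hqbar; exact hqbar rfl
  have hqdeg' : q.degree < (N : WithBot ℕ) := by
    rw [degree_eq_natDegree hq0, hqdeg, ← degree_eq_natDegree hp0]; exact hpdeg
  -- `x = c • q(γ)` over `E`
  have hxq : x.map (algebraMap 𝒪[E] E) = c • (aeval γ q).map (algebraMap 𝒪[E] E) := by
    rw [hp, hcq, map_smul, aeval_map_coe]
  by_cases hcO : valuation E c ≤ 1
  · -- `c ∈ 𝒪`: `x = (C c · q)(γ)`
    set cO : 𝒪[E] := ⟨c, (Valuation.mem_integer_iff _ _).2 hcO⟩ with hcO_def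
    have hcO0 : cO ≠ 0 := fun h => hc (congrArg Subtype.val h)
    refine ⟨C cO * q, ?_, hMinj ?_⟩
    · rw [degree_C_mul hcO0]; exact hqdeg'
    · change x.map (algebraMap 𝒪[E] E) = (aeval γ (C cO * q)).map (algebraMap 𝒪[E] E)
      rw [hxq, map_mul, aeval_C, ← Algebra.smul_def, Matrix.map_smul' _ _ _ (map_mul _)]
      rfl
  · -- `c ∉ 𝒪`: `c⁻¹ ∈ 𝔪` and `q(γ) = c⁻¹ • x ≡ 0 (mod 𝔪)` with `q̄ ≠ 0` — impossible by (R)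
    exfalso
    have hlt : valuation E c⁻¹ < 1 := by
      rw [map_inv₀]; exact inv_lt_one_of_one_lt₀ (not_le.1 hcO)
    set d : 𝒪[E] := ⟨c⁻¹, (Valuation.mem_integer_iff _ _).2 hlt.le⟩ with hd
    have hdm : IsLocalRing.residue 𝒪[E] d = 0 := by
      rw [residue_eq_zero_iff, IsLocalRing.mem_maximalIdeal, mem_nonunits_iff]
      exact Valuation.Integer.not_isUnit_iff_valuation_lt_one.2 hlt
    have hq : aeval γ q = d • x := by
      refine hMinj ?_
      change (aeval γ q).map (algebraMap 𝒪[E] E) = (d • x).map (algebraMap 𝒪[E] E)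
      rw [Matrix.map_smul' _ _ _ (map_mul _), hxq, smul_smul, show algebraMap 𝒪[E] E d = c⁻¹ from rfl, inv_mul_cancel₀ hc,
        one_smul]
    have hqN : q.natDegree < N := (natDegree_lt_iff_degree_lt hq0).2 hqdeg'
    refine hqbar (map_residue_eq_zero_of_aeval_map_residue_eq_zero γ hsep q hqN ?_)
    rw [hq, Matrix.map_smul' _ _ _ (map_mul _), hdm, zero_smul]

/-- **The commutant of a residually separable `γ` is commutative.** [cite: Kottwitz1986, §7 Prop. 7.1] -/
theorem commute_of_commute_residuallySeparable (hsep : (γ.charpoly.map (IsLocalRing.residue 𝒪[E])).Separable)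
    {x y : Matrix (Fin N) (Fin N) 𝒪[E]} (hx : Commute γ x) (hy : Commute γ y) : Commute x y := by
  obtain ⟨p, -, rfl⟩ := exists_eq_aeval_of_commute_residuallySeparable γ hsep x hx
  obtain ⟨q, -, rfl⟩ := exists_eq_aeval_of_commute_residuallySeparable γ hsep y hy
  change aeval γ p * aeval γ q = aeval γ q * aeval γ p
  rw [← map_mul, ← map_mul, mul_comm p q]

/-- `p(γ)` commutes with `γ`. [folklore] -/
private theorem commute_aeval (p : 𝒪[E][X]) : Commute γ (aeval γ p) := by
  change γ * aeval γ p = aeval γ p * γ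
  have h : aeval γ (X * p) = aeval γ (p * X) := by rw [mul_comm]
  rwa [map_mul, map_mul, aeval_X] at h

/-- **`Z_{M_N(𝒪_E)}(γ) = 𝒪_E[γ]` as subalgebras**: the centraliser of `{γ}` is the range of `p ↦ p(γ)`. [cite: Kottwitz1986, §7 Prop. 7.1] -/
theorem centralizer_eq_range_aeval_residuallySeparable (hsep : (γ.charpoly.map (IsLocalRing.residue 𝒪[E])).Separable) :
    Subalgebra.centralizer 𝒪[E] ({γ} : Set (Matrix (Fin N) (Fin N) 𝒪[E])) = (aeval γ : 𝒪[E][X] →ₐ[𝒪[E]] _).range := by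
  ext x
  rw [Subalgebra.mem_centralizer_iff, AlgHom.mem_range]
  simp only [Set.mem_singleton_iff, forall_eq]
  constructor
  · intro h
    obtain ⟨p, -, hp⟩ := exists_eq_aeval_of_commute_residuallySeparable γ hsep x h
    exact ⟨p, hp.symm⟩
  · rintro ⟨p, rfl⟩
    exact (commute_aeval γ p).eq

/-- **The `CommRing` transport `AdjoinRoot χ_γ ≃ₐ[𝒪_E] Z_{M_N(𝒪_E)}(γ)`, `p̄ ↦ p(γ)`**: the abstract order of §1 IS the matrix commutant (injective by
`charpoly_dvd_of_aeval_eq_zero`, onto by `exists_eq_aeval_of_commute_residuallySeparable`) — so §1's completeness ∕ finite reduced residue ring ∕ norm equation apply to the commutant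
of `γ` in `M_N(𝒪_E)`. [cite: Kottwitz1986, §7 Prop. 7.1] [cite: Rogawski1990, §4.3 p. 43] -/
theorem exists_algEquiv_adjoinRoot_centralizer (hsep : (γ.charpoly.map (IsLocalRing.residue 𝒪[E])).Separable) :
    ∃ e : AdjoinRoot γ.charpoly ≃ₐ[𝒪[E]] ↥(Subalgebra.centralizer 𝒪[E] ({γ} : Set (Matrix (Fin N) (Fin N) 𝒪[E]))),
      ∀ p : 𝒪[E][X], ((e (AdjoinRoot.mk γ.charpoly p) : ↥(Subalgebra.centralizer 𝒪[E] ({γ} : Set (Matrix (Fin N) (Fin N) 𝒪[E])))) :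
        Matrix (Fin N) (Fin N) 𝒪[E]) = aeval γ p := by
  have hker : ∀ a ∈ Ideal.span {γ.charpoly}, (aeval γ : 𝒪[E][X] →ₐ[𝒪[E]] Matrix (Fin N) (Fin N) 𝒪[E]) a = 0 := by
    intro a ha
    obtain ⟨b, rfl⟩ := Ideal.mem_span_singleton.1 ha
    rw [map_mul, Matrix.aeval_self_charpoly, zero_mul]
  let ψ : AdjoinRoot γ.charpoly →ₐ[𝒪[E]] Matrix (Fin N) (Fin N) 𝒪[E] := Ideal.Quotient.liftₐ (Ideal.span {γ.charpoly}) (aeval γ) hker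
  have hψ : ∀ p : 𝒪[E][X], ψ (AdjoinRoot.mk γ.charpoly p) = aeval γ p := fun p => rfl
  have hinj : Function.Injective ψ := by
    rw [injective_iff_map_eq_zero]
    intro z hz
    induction z using AdjoinRoot.induction_on with
    | ih p =>
      rw [hψ] at hz
      exact AdjoinRoot.mk_eq_zero.2 (charpoly_dvd_of_aeval_eq_zero γ hsep p hz)
  have hrange : ψ.range = Subalgebra.centralizer 𝒪[E] ({γ} : Set (Matrix (Fin N) (Fin N) 𝒪[E])) := by
    rw [centralizer_eq_range_aeval_residuallySeparable γ hsep]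
    ext x
    simp only [AlgHom.mem_range]
    constructor
    · rintro ⟨z, rfl⟩
      induction z using AdjoinRoot.induction_on with
      | ih p => exact ⟨p, (hψ p).symm⟩
    · rintro ⟨p, rfl⟩
      exact ⟨AdjoinRoot.mk _ p, hψ p⟩
  refine ⟨(AlgEquiv.ofInjective ψ hinj).trans (Subalgebra.equivOfEq _ _ hrange), fun p => ?_⟩
  rw [AlgEquiv.trans_apply]
  change ((AlgEquiv.ofInjective ψ hinj (AdjoinRoot.mk γ.charpoly p) : ψ.range) : Matrix (Fin N) (Fin N) 𝒪[E]) = aeval γ p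
  rw [AlgEquiv.ofInjective_apply, hψ]

end Commutant

end Literature.NumberTheory.LocalFields

end
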